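import Literature.NumberTheory.LFunctions.DobnerNewman
import Mathlib.NumberTheory.LSeries.Convergence
import Mathlib.Analysis.Normed.Module.FiniteDimension
import HarnessLib

/-!
# Bohr's almost periodicity of absolutely convergent Dirichlet series — the discharge

Trunk T-ANT (`Literature/NumberTheory/LFunctions`). Proofs only, companion of `DobnerNewman.lean`:
**discharge of the named fact `Literature.NumberTheory.LFunctions.bohr_almost_periodic`** (H. Bohr, *Über eine quasi-periodische
Eigenschaft Dirichletscher Reihen mit Anwendung auf die Dirichletschen `L`-Funktionen*, Math. Ann.
85 (1922), 115–122, **Satz 1**, in the vertical-strip form of A. Dobner, Acta Arith. 201 (2021),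
**Thm. 5**): if `G(s) = Σ b_n n^{-s}` converges absolutely for `Re s > σ`, then for `ε > 0` and
`σ < α < β` there are shifts `0 < τ_1 < τ_2 < ⋯` with `liminf (τ_{m+1} − τ_m) > 0`,
`limsup τ_m/m < ∞` and `|G(s) − G(s + iτ_m)| < ε` on `α ≤ Re s ≤ β`.

## The argument (Bohr's, §1 of the source: truncation and Diophantine approximation; the
approximation step is done here by compactness of the torus)

* **Truncation.** On `Re s ≥ α` the terms are dominated by `w_n = |b_n| n^{-α}`, `Σ w_n < ∞`;
  choose `N` with `Σ_{n ≥ N} w_n < ε/8`. Since `n^{-(s+iT)} = n^{-s} n^{-iT}`,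
  `|G(s + iT) − G(s + iT')| ≤ Σ_{n<N} w_n |n^{-iT} − n^{-iT'}| + 2 Σ_{n≥N} w_n < ε` as soon as
  `|n^{-iT} − n^{-iT'}| ≤ η := ε/(4(W+1))` for all `n < N` (`W = Σ_{n<N} w_n`) — `key` below.
* **Compactness.** The orbit `{(n^{-iT})_{n<N} : T ∈ ℝ}` lies in the unit ball of `ℂ^N`, a
  totally bounded set: finitely many `T'_1, …, T'_k` (`|T'_j| ≤ A`) are such that every `T` has
  some `j` with `|n^{-iT} − n^{-iT'_j}| < η` for all `n < N`. Then `τ = T − T'_j` is an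
  `ε`-translation number of `G` on the strip (substitute `s ↦ s − iT'_j`), and `|τ − T| ≤ A`: the
  `ε`-translation numbers are *relatively dense* (one in every interval of length `2A`).
* **The sequence.** With `L₀ = 2A + 1` and `T_m = (2m+1)L₀ + A`, the translation numbers
  `τ_m ∈ [(2m+1)L₀, (2m+1)L₀ + 2A]` satisfy `τ_0 > 0`, `τ_{m+1} − τ_m ≥ 1`, `τ_m ≤ 2L₀(m+1)`.

## Main result

* `Literature.bohr_almost_periodic_holds : bohr_almost_periodic`.

## References

* H. Bohr, Math. Ann. 85 (1922), 115–122, §1, Satz 1.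
* A. Dobner, Acta Arith. 201 (2021), 29–62 = arXiv:2005.05142, Thm. 5.
-/

noncomputable section

open Complex Filter Set Topology Metric Finset

namespace Literature.NumberTheory.LFunctions

/-! ## Terms of a Dirichlet series under vertical shifts -/

/-- The unimodular factor `n^{-iT}`. [folklore] -/
theorem norm_natCast_cpow_neg_mul_I {n : ℕ} (hn : n ≠ 0) (T : ℝ) :
    ‖(n : ℂ) ^ (-(T * I))‖ = 1 := by
  rw [Complex.norm_natCast_cpow_of_pos (Nat.pos_of_ne_zero hn)]
  simp

/-- `n^{-(s + iT)} = n^{-s} · n^{-iT}` on the terms of an `LSeries`. [folklore] -/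
theorem LSeries_term_add_mul_I (b : ℕ → ℂ) (s : ℂ) (T : ℝ) (n : ℕ) :
    LSeries.term b (s + T * I) n = LSeries.term b s n * (n : ℂ) ^ (-(T * I)) := by
  rcases eq_or_ne n 0 with rfl | hn
  · simp
  have hn' : (n : ℂ) ≠ 0 := by exact_mod_cast hn
  have h1 : (n : ℂ) ^ s ≠ 0 := Complex.cpow_ne_zero_iff.2 (Or.inl hn')
  have h2 : (n : ℂ) ^ ((T : ℂ) * I) ≠ 0 := Complex.cpow_ne_zero_iff.2 (Or.inl hn')
  rw [LSeries.term_of_ne_zero hn, LSeries.term_of_ne_zero hn, Complex.cpow_add _ _ hn',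
    Complex.cpow_neg]
  field_simp

/-! ## The discharge -/

/-- **Discharge of `Literature.NumberTheory.LFunctions.bohr_almost_periodic`** (Bohr 1922, Satz 1; Dobner 2021, Thm. 5).
[cite: BohrMA1922, Satz 1] -/
theorem bohr_almost_periodic_holds : bohr_almost_periodic := by
  intro b α β ε hα hαβ hε
  -- absolute convergence at `α` and the dominating sequence `w`
  have hsumα : LSeriesSummable b α :=
    LSeriesSummable_of_abscissaOfAbsConv_lt_re (by simpa using hα)
  set w : ℕ → ℝ := fun n ↦ ‖LSeries.term b α n‖ with hw
  have hws : Summable w := hsumα.norm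
  have hw0 : ∀ n, 0 ≤ w n := fun n ↦ norm_nonneg _
  -- truncation index
  obtain ⟨N, hN⟩ : ∃ N : ℕ, ∑' k, w (k + N) < ε / 8 :=
    ((tendsto_sum_nat_add w).eventually (gt_mem_nhds (by positivity))).exists
  set W : ℝ := ∑ n ∈ Finset.range N, w n with hW
  have hW0 : 0 ≤ W := Finset.sum_nonneg fun n _ ↦ hw0 n
  set η : ℝ := ε / (4 * (W + 1)) with hη
  have hη0 : 0 < η := by positivity
  have hηW : W * η ≤ ε / 4 := by
    rw [hη, mul_div_assoc', div_le_div_iff₀ (by positivity) (by positivity)]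
    nlinarith
  -- summability of the shifted series on the half-plane `Re s ≥ α`
  have hsum : ∀ s : ℂ, α ≤ s.re → Summable fun n ↦ LSeries.term b s n := fun s hs ↦
    Summable.of_norm_bounded hws fun n ↦ LSeries.norm_term_le_of_re_le_re b hs n
  -- KEY: closeness of two shifts from closeness of the unimodular factors
  have key : ∀ s : ℂ, α ≤ s.re → ∀ T T' : ℝ,
      (∀ n ∈ Finset.range N, ‖(n : ℂ) ^ (-(T * I)) - (n : ℂ) ^ (-(T' * I))‖ ≤ η) →
      ‖LSeries b (s + T * I) - LSeries b (s + T' * I)‖ < ε := by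
    intro s hs T T' hclose
    set d : ℕ → ℂ := fun n ↦ LSeries.term b (s + T * I) n - LSeries.term b (s + T' * I) n with hd
    have hsT : α ≤ (s + T * I).re := by simpa using hs
    have hsT' : α ≤ (s + T' * I).re := by simpa using hs
    have hds : Summable d := (hsum _ hsT).sub (hsum _ hsT')
    have hdn : Summable fun n ↦ ‖d n‖ := by
      refine Summable.of_nonneg_of_le (fun n ↦ norm_nonneg _) (fun n ↦ ?_) ((hws.add hws))
      exact (norm_sub_le _ _).trans (add_le_add (LSeries.norm_term_le_of_re_le_re b hsT n)
        (LSeries.norm_term_le_of_re_le_re b hsT' n))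
    have hdiff : LSeries b (s + T * I) - LSeries b (s + T' * I) = ∑' n, d n := by
      rw [LSeries, LSeries, ← Summable.tsum_sub (hsum _ hsT) (hsum _ hsT')]
    rw [hdiff, ← Summable.sum_add_tsum_nat_add N hds]
    -- head
    have hhead : ‖∑ n ∈ Finset.range N, d n‖ ≤ W * η := by
      refine (norm_sum_le _ _).trans ?_
      rw [hW, Finset.sum_mul]
      refine Finset.sum_le_sum fun n hn ↦ ?_
      have e : d n = LSeries.term b s n * ((n : ℂ) ^ (-(T * I)) - (n : ℂ) ^ (-(T' * I))) := by
        rw [hd]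
        simp only
        rw [LSeries_term_add_mul_I, LSeries_term_add_mul_I]
        ring
      rw [e, norm_mul]
      exact mul_le_mul (LSeries.norm_term_le_of_re_le_re b hs n) (hclose n hn) (norm_nonneg _) (hw0 n)
    -- tail
    have htail : ‖∑' n, d (n + N)‖ ≤ 2 * ∑' k, w (k + N) := by
      have h1 : Summable fun n ↦ ‖d (n + N)‖ := (summable_nat_add_iff N).2 hdn
      have h2 : Summable fun n ↦ w (n + N) := (summable_nat_add_iff N).2 hws
      refine (norm_tsum_le_tsum_norm h1).trans ?_
      rw [← tsum_mul_left]
      refine Summable.tsum_le_tsum (fun n ↦ ?_) h1 (h2.mul_left 2)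
      calc ‖d (n + N)‖ ≤ ‖LSeries.term b (s + T * I) (n + N)‖ + ‖LSeries.term b (s + T' * I) (n + N)‖ :=
            norm_sub_le _ _
        _ ≤ w (n + N) + w (n + N) := add_le_add (LSeries.norm_term_le_of_re_le_re b hsT _)
            (LSeries.norm_term_le_of_re_le_re b hsT' _)
        _ = 2 * w (n + N) := by ring
    calc ‖∑ n ∈ Finset.range N, d n + ∑' n, d (n + N)‖
        ≤ ‖∑ n ∈ Finset.range N, d n‖ + ‖∑' n, d (n + N)‖ := norm_add_le _ _
      _ ≤ W * η + 2 * ∑' k, w (k + N) := add_le_add hhead htail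
      _ < ε / 4 + 2 * (ε / 8) := by linarith
      _ ≤ ε := by linarith
  -- COMPACTNESS: the orbit of the unimodular vectors is totally bounded
  set v : ℝ → (Fin N → ℂ) := fun T n ↦ ((n : ℕ) : ℂ) ^ (-(T * I)) with hv
  have hvball : Set.range v ⊆ closedBall (0 : Fin N → ℂ) 1 := by
    rintro _ ⟨T, rfl⟩
    rw [mem_closedBall_zero_iff, pi_norm_le_iff_of_nonneg zero_le_one]
    intro n
    simp only [hv]
    rcases eq_or_ne (n : ℕ) 0 with h | h
    · rw [h, Nat.cast_zero]
      by_cases hx : (-((T : ℂ) * I)) = 0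
      · rw [hx, Complex.cpow_zero]; simp
      · rw [Complex.zero_cpow hx]; simp
    · rw [norm_natCast_cpow_neg_mul_I h]
  have htb : TotallyBounded (Set.range v) :=
    (isCompact_closedBall (0 : Fin N → ℂ) 1).totallyBounded.subset hvball
  obtain ⟨t, htv, htfin, hcover⟩ := Metric.finite_approx_of_totallyBounded htb η hη0
  -- representatives `T'` of the finitely many centres, and the bound `A`
  have hrep : ∀ y ∈ t, ∃ T : ℝ, v T = y := fun y hy ↦ htv hy
  choose! rep hrep using hrep
  set A : ℝ := ∑ y ∈ htfin.toFinset, |rep y| with hA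
  have hA0 : 0 ≤ A := Finset.sum_nonneg fun y _ ↦ abs_nonneg _
  have happrox : ∀ T : ℝ, ∃ T' : ℝ, |T'| ≤ A ∧
      ∀ n ∈ Finset.range N, ‖(n : ℂ) ^ (-(T * I)) - (n : ℂ) ^ (-(T' * I))‖ ≤ η := by
    intro T
    have hT : v T ∈ Set.range v := ⟨T, rfl⟩
    obtain ⟨y, hy, hTy⟩ : ∃ y ∈ t, v T ∈ ball y η := by simpa using hcover hT
    refine ⟨rep y, ?_, fun n hn ↦ ?_⟩
    · rw [hA]
      exact Finset.single_le_sum (f := fun y ↦ |rep y|) (fun y _ ↦ abs_nonneg _)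
        (htfin.mem_toFinset.2 hy)
    · rw [Finset.mem_range] at hn
      have h1 : dist (v T) (v (rep y)) < η := by rw [hrep y hy]; exact hTy
      have h2 := (dist_le_pi_dist (v T) (v (rep y)) ⟨n, hn⟩).trans h1.le
      rw [dist_eq_norm] at h2
      simpa [hv] using h2
  -- relative density ⇒ the sequence
  set L₀ : ℝ := 2 * A + 1 with hL₀
  have hL₀0 : 0 < L₀ := by positivity
  choose T' hT'A hT'close using fun m : ℕ ↦ happrox ((2 * m + 1) * L₀ + A)
  set τ : ℕ → ℝ := fun m ↦ (2 * m + 1) * L₀ + A - T' m with hτ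
  have hτlow : ∀ m : ℕ, (2 * m + 1) * L₀ ≤ τ m := fun m ↦ by
    simp only [hτ]; linarith [(abs_le.1 (hT'A m)).2]
  have hτup : ∀ m : ℕ, τ m ≤ (2 * m + 1) * L₀ + 2 * A := fun m ↦ by
    simp only [hτ]; linarith [(abs_le.1 (hT'A m)).1]
  have hgap : ∀ m : ℕ, 1 ≤ τ (m + 1) - τ m := fun m ↦ by
    have h1 := hτlow (m + 1)
    have h2 := hτup m
    push_cast at h1
    rw [hL₀] at h1 h2
    nlinarith
  refine ⟨τ, strictMono_nat_of_lt_succ fun m ↦ by linarith [hgap m], ?_, ⟨1, one_pos,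
    Eventually.of_forall hgap⟩, ⟨2 * L₀, fun m ↦ ?_⟩, fun m s hsα hsβ ↦ ?_⟩
  · have := hτlow 0
    simp at this
    linarith
  · have := hτup m
    rw [hL₀] at this ⊢
    nlinarith
  · -- translation property: substitute `s ↦ s − i T'_m`
    have h := key (s - T' m * I) (by simpa using hsα) (T' m) ((2 * m + 1) * L₀ + A)
      (fun n hn ↦ by rw [norm_sub_rev]; exact hT'close m n hn)
    have e1 : s - T' m * I + T' m * I = s := by ring
    have e2 : s - T' m * I + (((2 * m + 1) * L₀ + A : ℝ) : ℂ) * I = s + τ m * I := by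
      simp only [hτ]; push_cast; ring
    rwa [e1, e2] at h

end Literature.NumberTheory.LFunctions
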